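import Literature.InformationTheory.StateDiscrimination.MultiparameterQuantumCramerRaoBound
import Mathlib.LinearAlgebra.Matrix.Vec
import HarnessLib

/-!
# Computing the quantum Fisher information matrix: the eigenbasis formula (any rank), the existence of SLDs
# for full-rank states, Šafránek's Liouville-space formula `𝓕_ab = 2vec(∂_aρ)†(ρ̄⊗1 + 1⊗ρ)⁻¹vec(∂_bρ)`,
# and Dittmann's basis-independent qubit formula `𝓕_ab = Tr(∂_aρ∂_bρ) + Tr(ρ∂_aρρ∂_bρ)/det ρ`
# (Liu–Yuan–Lu–Wang 2020 § 2.3.1 Thm 2.1 / Eq. after it / Thm 2.3, § 2.3.3 Thm 2.6 and Cor. 2)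

Hodge foundations lane (`lit-hodgefound`, prover p24 gen 80; quantum-information series).  THEOREMS ONLY: no
definition, no named fact, net debt 0.  Vocabulary of `QuantumFisherInformationMatrix.lean` (p24 g80-#1): state
`ρ`, derivative data `D a = ∂_aρ`, SLDs `S a` with `S_aρ + ρS_a = D_a` (BF normalisation, `L_a = 2S_a`), QFIM
`hF : F a b = 2 Re Tr(S_a D_b)`.  Spectral data are ABSTRACT: a unitary `U` (`U†U = UU† = 1`) and real `d` with
`ρ = U diag(d) U†`, so that `⟨λ_i|X|λ_j⟩ = (U†XU)_ij`; Mathlib's `spectral_theorem` supplies them for Hermitian `ρ`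
(see `QFIVariance.exists_sld_unitaryDeriv`, p24 g79, for that road).  Liouville space is Mathlib's
COLUMN-stacking `Matrix.vec` (`vec(AXB) = (Bᵀ ⊗ A)vec X`, `Matrix.kronecker_mulVec_vec`), in which the SLD
super-operator `X ↦ Xρ + ρX` is `ρᵀ ⊗ 1 + 1 ⊗ ρ` (Liu's ROW-stacking convention prints it as `ρ ⊗ 1 + 1 ⊗ ρ*`;
`ρᵀ = ρ̄ = ρ*` for Hermitian `ρ`).

## Source, VERBATIM

J. Liu, H. Yuan, X.-M. Lu, X. Wang, *Quantum Fisher information matrix and multiparameter estimation*, J. Phys. A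
53 (2020) 023001 [LiuYuanLuWang2020], held `paper:arxiv-1907.08037`.  § 2.3.1 (p0005): «**Theorem 2.1** The entry
of QFIM for a full-rank density matrix with the spectral decomposition `ρ = Σ_{i=0}^{d−1} λ_i|λ_i⟩⟨λ_i|` can be
written as `𝓕_ab = Σ_{i,j=0}^{d−1} 2Re(⟨λ_i|∂_aρ|λ_j⟩⟨λ_j|∂_bρ|λ_i⟩)/(λ_i + λ_j)` … if the density matrix is not
of full rank, there can be divergent terms in the above equation. To extend it to the general density matrices
which may not have full rank, we can manually remove the divergent terms as
`𝓕_ab = Σ_{i,j=0, λ_i+λ_j≠0}^{d−1} 2Re(⟨λ_i|∂_aρ|λ_j⟩⟨λ_j|∂_bρ|λ_i⟩)/(λ_i + λ_j)`.»  (p0006): «Denote `vec(A)` as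
the column vector of `A` in Liouville space and `vec(A)†` as the conjugate transpose of `vec(A)`. …
**Theorem 2.3** For a full-rank density matrix, the QFIM can be expressed by [Safranek]
`𝓕_ab = 2vec(∂_aρ)†(ρ ⊗ 𝟙 + 𝟙 ⊗ ρ*)⁻¹vec(∂_bρ)`, where `ρ*` is the conjugate of `ρ`, and the SLD operator in
Liouville space, denoted by `vec(L_a)`, reads `vec(L_a) = 2(ρ ⊗ 𝟙 + 𝟙 ⊗ ρ*)⁻¹vec(∂_aρ)`.  This theorem can be
proved by using the facts that `vec(ABC) = (A ⊗ Cᵀ)vec(B)` … and `Tr(A†B) = vec(A)†vec(B)`.»  § 2.3.3 (p0007):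
«**Theorem 2.6** The basis-independent expression of QFIM for a single-qubit mixed state `ρ` is of the following
form `𝓕_ab = Tr[(∂_aρ)(∂_bρ)] + (1/det(ρ)) Tr[ρ(∂_aρ)ρ(∂_bρ)]`, where `det(ρ)` is the determinant of `ρ`. For a
single-qubit pure state, `𝓕_ab = 2Tr[(∂_aρ)(∂_bρ)]`. Equation (…) is the reduced form of the one given in reference
[Dittmann1999].»  (p0006–p0007): «**Corollary 2** For a single-qubit mixed state, the QFIM in Bloch representation
can be expressed by `𝓕_ab = (∂_a r⃗)·(∂_b r⃗) + (r⃗·∂_a r⃗)(r⃗·∂_b r⃗)/(1 − |r⃗|²)`, where `|r⃗|` is the norm of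
`r⃗`. For a single-qubit pure state, `𝓕_ab = (∂_a r⃗)·(∂_b r⃗)`.» (`ρ = (𝟙 + r⃗·σ⃗)/2`.)

## Roads (no definitions introduced)

* § 1 (Thm 2.1, any rank): in the eigenbasis the SLD equation reads `(U†D_aU)_ij = (U†S_aU)_ij (λ_i + λ_j)`, and
  `Tr(S_aD_b) = Σ_ij (U†S_aU)_ij (U†D_bU)_ji`; a pair with `λ_i + λ_j = 0` contributes `0` on both sides, which is
  exactly Lean's `x/0 = 0` reading of «remove the divergent terms» — so the printed sum IS `𝓕_ab` for every state
  admitting SLDs, with no positivity hypothesis.  For `λ_i + λ_j ≠ 0` for all `i, j` (full rank),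
  `S := U T U†`, `T_ij = (U†DU)_ij/(λ_i + λ_j)` is a Hermitian SLD (existence).
* § 2 (Thm 2.3): `(ρᵀ ⊗ 1 + 1 ⊗ ρ)vec S = vec(Sρ + ρS)`; for `ρ ≻ 0` this Kronecker sum is positive definite
  (Mathlib `PosDef.kronecker`), hence invertible, so `vec S_a = M⁻¹vec D_a` (`vec L_a = 2M⁻¹vec ∂_aρ`) and
  `𝓕_ab = 2Tr(S_bD_a) = 2 vec(D_a)†vec(S_b) = 2vec(∂_aρ)†M⁻¹vec(∂_bρ)` (`Matrix.star_vec_dotProduct_vec`).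
* § 3 (Thm 2.6): for `2 × 2` matrices `AB + BA = Tr(B)A + Tr(A)B + (Tr(AB) − TrA TrB)1` and
  `ρ² = Tr(ρ)ρ − det(ρ)1`; with `Tr ρ = 1`, `Tr ∂_aρ = 0`, `t_a = Tr(ρ∂_aρ)`: `ρD_a + D_aρ = D_a + t_a1`,
  `ρD_aρ = t_aρ + det(ρ)D_a`, and `S_a := D_a + (t_a/2det ρ)(ρ − 1)` solves the SLD equation; hence
  `2Tr(S_aD_b) = 2Tr(D_aD_b) + t_at_b/det ρ = Tr(D_aD_b) + Tr(ρD_aρD_b)/det ρ` — pure algebra over `ℂ`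
  (`det ρ ≠ 0`; no positivity used).  Cor. 2 is the instance `ρ = ½[[1+z, x−iy],[x+iy, 1−z]]`.

## What is formalized (all PROVED)

* § 1 `conj_deriv_apply_eq` (`(U†D_aU)_ij = (U†S_aU)_ij(λ_i+λ_j)`), `trace_sld_mul_deriv_eq_sum_conj`,
  **`qfim_eq_sum_eigenbasis`** (Thm 2.1 and the rank-deficient display, for every state admitting SLDs),
  `qfim_diag_eq_sum_eigenbasis` (`𝓕_aa = Σ_ij 2|⟨λ_i|∂_aρ|λ_j⟩|²/(λ_i+λ_j)`), `lyapunov_conj_isHermitian`,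
  **`exists_sld_of_forall_add_ne_zero`** / `exists_sld_of_pos` (existence of Hermitian SLDs for full-rank states).
* § 2 `kroneckerSum_mulVec_vec` (`(ρᵀ⊗1 + 1⊗ρ)vec S = vec(Sρ + ρS)`), **`kroneckerSum_posDef`**,
  `vec_sld_eq_inv_mulVec` (`vec S_a = M⁻¹ vec ∂_aρ`, i.e. `vec L_a = 2M⁻¹vec ∂_aρ`), `star_vec_dotProduct_vec_sld`,
  **`qfim_eq_two_mul_vec_inv_vec`** (Thm 2.3).
* § 3 (private `two_by_two_anticomm`, `two_by_two_sq`), `qubit_anticomm_deriv`, `qubit_conj_deriv`, **`sld_qubit`**,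
  `two_mul_trace_sld_qubit`, **`qfim_qubit`** (Thm 2.6), **`qfim_qubit_bloch`** (Cor. 2).

NOT formalized: Thm 2.2 (support form with eigenvector derivatives `|∂_aλ_i⟩`), Thm 2.4 (general-`d` Bloch form
with `SU(d)` structure constants), Thms 2.5/2.7–2.10 (pure/unitary/Gaussian forms — the pure case is g80-#1
`qfim_pure`).  Tree search (FAIL-DUP, 2026-09-01): the one-parameter eigenbasis formula is
`QFIVariance.qfi_unitary_eq_sum_eigenbasis` (unitary families only); `rg -n "Matrix.vec |Liouville" Literature`
→ no SLD/QFI use of `Matrix.vec`.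
-/

noncomputable section

open Matrix Finset
open scoped ComplexOrder ComplexConjugate Kronecker

namespace Literature.InformationTheory.StateDiscrimination.QFIMFormulas

open Literature.InformationTheory.StateDiscrimination.QFIM (trace_sld_mul_deriv_comm trace_sld_mul_deriv_eq_of_sld_eq)

variable {n ι : Type*} [Fintype n] [DecidableEq n]

/-! ## § 1 Theorem 2.1: the eigenbasis formula, valid for every state admitting SLDs -/

/-- **The SLD equation in the eigenbasis**: with `ρ = U diag(d) U†`, `U†U = 1` and `Sρ + ρS = D`,
`(U†DU)_ij = (U†SU)_ij (d_i + d_j)`. [cite: LiuYuanLuWang2020, §2.3.1 Thm 2.1 (proof in Appendix)] -/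
theorem conj_deriv_apply_eq {U ρ S D : Matrix n n ℂ} (hU : Uᴴ * U = 1) (d : n → ℝ)
    (hρU : ρ = U * diagonal (fun i => (d i : ℂ)) * Uᴴ) (hSD : S * ρ + ρ * S = D) (i j : n) :
    (Uᴴ * D * U) i j = (Uᴴ * S * U) i j * ((d i : ℂ) + d j) := by
  have h1 : Uᴴ * D * U = (Uᴴ * S * U) * diagonal (fun i => (d i : ℂ)) + diagonal (fun i => (d i : ℂ)) * (Uᴴ * S * U) := by
    have e1 : Uᴴ * (S * (U * diagonal (fun i => (d i : ℂ)) * Uᴴ)) * U =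
        Uᴴ * S * U * diagonal (fun i => (d i : ℂ)) := by
      calc Uᴴ * (S * (U * diagonal (fun i => (d i : ℂ)) * Uᴴ)) * U
          = Uᴴ * S * U * diagonal (fun i => (d i : ℂ)) * (Uᴴ * U) := by simp only [Matrix.mul_assoc]
        _ = Uᴴ * S * U * diagonal (fun i => (d i : ℂ)) := by rw [hU, Matrix.mul_one]
    have e2 : Uᴴ * (U * diagonal (fun i => (d i : ℂ)) * Uᴴ * S) * U =
        diagonal (fun i => (d i : ℂ)) * (Uᴴ * S * U) := by
      calc Uᴴ * (U * diagonal (fun i => (d i : ℂ)) * Uᴴ * S) * U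
          = (Uᴴ * U) * (diagonal (fun i => (d i : ℂ)) * (Uᴴ * S * U)) := by simp only [Matrix.mul_assoc]
        _ = diagonal (fun i => (d i : ℂ)) * (Uᴴ * S * U) := by rw [hU, Matrix.one_mul]
    rw [← hSD, hρU, Matrix.mul_add, Matrix.add_mul, e1, e2]
  rw [h1, Matrix.add_apply, mul_diagonal, diagonal_mul]
  ring

/-- **`Tr(S_aD_b)` in the eigenbasis**: `Tr(SD') = Σ_ij (U†SU)_ij (U†D'U)_ji` for `UU† = 1`.
[cite: LiuYuanLuWang2020, §2.3.1 Thm 2.1] -/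
theorem trace_sld_mul_deriv_eq_sum_conj {U : Matrix n n ℂ} (hU' : U * Uᴴ = 1) (S D' : Matrix n n ℂ) :
    (S * D').trace = ∑ i, ∑ j, (Uᴴ * S * U) i j * (Uᴴ * D' * U) j i := by
  have e : Uᴴ * S * U * (Uᴴ * D' * U) = Uᴴ * (S * D') * U := by
    calc Uᴴ * S * U * (Uᴴ * D' * U) = Uᴴ * S * (U * Uᴴ) * D' * U := by simp only [Matrix.mul_assoc]
      _ = Uᴴ * (S * D') * U := by rw [hU', Matrix.mul_one, Matrix.mul_assoc Uᴴ]
  have htr : (Uᴴ * S * U * (Uᴴ * D' * U)).trace = (S * D').trace := by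
    rw [e, Matrix.trace_mul_cycle, hU', Matrix.one_mul]
  rw [← htr]
  set T := Uᴴ * S * U
  set E := Uᴴ * D' * U
  simp only [Matrix.trace, Matrix.diag, Matrix.mul_apply]

omit [DecidableEq n] in
/-- `Re(z · r) / r`-bookkeeping: `2Re(t(d_i+d_j) e)/(d_i+d_j) = 2Re(te)` when `d_i + d_j ≠ 0`. [folklore] -/
private theorem two_mul_re_mul_ofReal_div (t e : ℂ) {r : ℝ} (hr : r ≠ 0) :
    2 * (t * (r : ℂ) * e).re / r = 2 * (t * e).re := by
  have : t * (r : ℂ) * e = (t * e) * (r : ℂ) := by ring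
  rw [this, Complex.re_mul_ofReal]
  field_simp

/-- **Theorem 2.1 / the rank-deficient display: the QFIM in the eigenbasis of `ρ`.**  For `ρ = U diag(λ) U†`
(`U` unitary, `λ` real — any rank, any signs) and ANY solutions `S_a` of the SLD equations,
`𝓕_ab = Σ_i Σ_j 2Re(⟨λ_i|∂_aρ|λ_j⟩⟨λ_j|∂_bρ|λ_i⟩)/(λ_i + λ_j)`, where `⟨λ_i|X|λ_j⟩ = (U†XU)_ij` and the terms with
`λ_i + λ_j = 0` are `0` (Lean's `x/0 = 0` — they vanish anyway since then `⟨λ_j|∂_bρ|λ_i⟩ = 0`).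
[cite: LiuYuanLuWang2020, §2.3.1 Thm 2.1 and the display after it («we can manually remove the divergent terms»)] -/
theorem qfim_eq_sum_eigenbasis {U : Matrix n n ℂ} (hU : Uᴴ * U = 1) (hU' : U * Uᴴ = 1) (d : n → ℝ)
    {ρ : Matrix n n ℂ} (hρU : ρ = U * diagonal (fun i => (d i : ℂ)) * Uᴴ) {S D : ι → Matrix n n ℂ}
    (hSD : ∀ a, S a * ρ + ρ * S a = D a) {F : Matrix ι ι ℝ} (hF : ∀ a b, F a b = 2 * (S a * D b).trace.re)
    (a b : ι) :
    F a b = ∑ i, ∑ j, 2 * ((Uᴴ * D a * U) i j * (Uᴴ * D b * U) j i).re / (d i + d j) := by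
  rw [hF, trace_sld_mul_deriv_eq_sum_conj hU' (S a) (D b), Complex.re_sum, Finset.mul_sum]
  refine Finset.sum_congr rfl fun i _ => ?_
  rw [Complex.re_sum, Finset.mul_sum]
  refine Finset.sum_congr rfl fun j _ => ?_
  rw [conj_deriv_apply_eq hU d hρU (hSD a) i j]
  by_cases hr : d i + d j = 0
  · -- a «divergent» pair: both sides vanish
    have hji : (Uᴴ * D b * U) j i = 0 := by
      rw [conj_deriv_apply_eq hU d hρU (hSD b) j i]
      have : ((d j : ℂ) + d i) = 0 := by exact_mod_cast (by linarith : d j + d i = 0)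
      rw [this, mul_zero]
    rw [hji, hr]
    simp
  · rw [← Complex.ofReal_add]
    exact (two_mul_re_mul_ofReal_div _ _ hr).symm

/-- **The diagonal (the QFI)**: `𝓕_aa = Σ_ij 2|⟨λ_i|∂_aρ|λ_j⟩|²/(λ_i + λ_j)` for Hermitian `∂_aρ` (Paris (11) / Liu
Cor. 1 form of the diagonal). [cite: LiuYuanLuWang2020, §2.3.1 Thm 2.1] -/
theorem qfim_diag_eq_sum_eigenbasis {U : Matrix n n ℂ} (hU : Uᴴ * U = 1) (hU' : U * Uᴴ = 1) (d : n → ℝ)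
    {ρ : Matrix n n ℂ} (hρU : ρ = U * diagonal (fun i => (d i : ℂ)) * Uᴴ) {S D : ι → Matrix n n ℂ}
    (hD : ∀ a, (D a).IsHermitian) (hSD : ∀ a, S a * ρ + ρ * S a = D a) {F : Matrix ι ι ℝ}
    (hF : ∀ a b, F a b = 2 * (S a * D b).trace.re) (a : ι) :
    F a a = ∑ i, ∑ j, 2 * ‖(Uᴴ * D a * U) i j‖ ^ 2 / (d i + d j) := by
  rw [qfim_eq_sum_eigenbasis hU hU' d hρU hSD hF]
  refine Finset.sum_congr rfl fun i _ => Finset.sum_congr rfl fun j _ => ?_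
  have hE : (Uᴴ * D a * U).IsHermitian := isHermitian_conjTranspose_mul_mul U (hD a)
  have hji : (Uᴴ * D a * U) j i = star ((Uᴴ * D a * U) i j) := by
    rw [← conjTranspose_apply, hE.eq]
  rw [hji, Complex.star_def, Complex.mul_conj, Complex.ofReal_re, Complex.normSq_eq_norm_sq]

omit [Fintype n] [DecidableEq n] in
/-- The eigenbasis Lyapunov solution `T_ij = E_ij/(d_i + d_j)` is Hermitian when `E` is. [cite: LiuYuanLuWang2020, §2.3.1 Thm 2.1] -/
theorem lyapunov_conj_isHermitian {E : Matrix n n ℂ} (hE : E.IsHermitian) (d : n → ℝ) :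
    (Matrix.of fun i j => E i j / ((d i : ℂ) + d j)).IsHermitian := by
  refine Matrix.IsHermitian.ext fun i j => ?_
  have hij : star (E j i) = E i j := by rw [← conjTranspose_apply, hE.eq]
  rw [of_apply, of_apply, star_div₀, hij, star_add]
  simp only [Complex.star_def, Complex.conj_ofReal]
  rw [add_comm]

/-- **Existence of SLDs for full-rank states**: if `ρ = U diag(d) U†` with `d_i + d_j ≠ 0` for all `i, j` (e.g. all
`d_i > 0`), then every Hermitian `D` has a Hermitian SLD, namely `S = U T U†` with `T_ij = (U†DU)_ij/(d_i + d_j)`.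
[cite: LiuYuanLuWang2020, §2.3.1 Thm 2.1 («for a full-rank density matrix … it is usually assumed that `λ_i > 0`»)] -/
theorem exists_sld_of_forall_add_ne_zero {U : Matrix n n ℂ} (hU : Uᴴ * U = 1) (hU' : U * Uᴴ = 1) {d : n → ℝ}
    (hd : ∀ i j, d i + d j ≠ 0) {ρ : Matrix n n ℂ} (hρU : ρ = U * diagonal (fun i => (d i : ℂ)) * Uᴴ)
    {D : Matrix n n ℂ} (hD : D.IsHermitian) : ∃ S : Matrix n n ℂ, S.IsHermitian ∧ S * ρ + ρ * S = D := by
  set E := Uᴴ * D * U with hE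
  set T : Matrix n n ℂ := Matrix.of fun i j => E i j / ((d i : ℂ) + d j) with hT
  refine ⟨U * T * Uᴴ, isHermitian_mul_mul_conjTranspose U
    (lyapunov_conj_isHermitian (isHermitian_conjTranspose_mul_mul U hD) d), ?_⟩
  -- `TΛ + ΛT = E`
  have hTE : T * diagonal (fun i => (d i : ℂ)) + diagonal (fun i => (d i : ℂ)) * T = E := by
    ext i j
    rw [Matrix.add_apply, mul_diagonal, diagonal_mul, hT, of_apply]
    have hc : ((d i : ℂ) + d j) ≠ 0 := by exact_mod_cast hd i j
    field_simp
    ring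
  -- conjugate back
  have e1 : U * T * Uᴴ * ρ = U * (T * diagonal (fun i => (d i : ℂ))) * Uᴴ := by
    rw [hρU]
    calc U * T * Uᴴ * (U * diagonal (fun i => (d i : ℂ)) * Uᴴ)
        = U * T * (Uᴴ * U) * diagonal (fun i => (d i : ℂ)) * Uᴴ := by simp only [Matrix.mul_assoc]
      _ = U * (T * diagonal (fun i => (d i : ℂ))) * Uᴴ := by rw [hU, Matrix.mul_one, Matrix.mul_assoc U T]
  have e2 : ρ * (U * T * Uᴴ) = U * (diagonal (fun i => (d i : ℂ)) * T) * Uᴴ := by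
    rw [hρU]
    calc U * diagonal (fun i => (d i : ℂ)) * Uᴴ * (U * T * Uᴴ)
        = U * diagonal (fun i => (d i : ℂ)) * (Uᴴ * U) * T * Uᴴ := by simp only [Matrix.mul_assoc]
      _ = U * (diagonal (fun i => (d i : ℂ)) * T) * Uᴴ := by
          rw [hU, Matrix.mul_one, Matrix.mul_assoc U (diagonal _)]
  rw [e1, e2, ← Matrix.add_mul, ← Matrix.mul_add, hTE, hE]
  calc U * (Uᴴ * D * U) * Uᴴ = (U * Uᴴ) * D * (U * Uᴴ) := by simp only [Matrix.mul_assoc]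
    _ = D := by rw [hU', Matrix.one_mul, Matrix.mul_one]

/-- Full-rank states (`λ_i > 0`) admit Hermitian SLDs for every Hermitian derivative. [cite: LiuYuanLuWang2020, §2.3.1 Thm 2.1] -/
theorem exists_sld_of_pos {U : Matrix n n ℂ} (hU : Uᴴ * U = 1) (hU' : U * Uᴴ = 1) {d : n → ℝ}
    (hd : ∀ i, 0 < d i) {ρ : Matrix n n ℂ} (hρU : ρ = U * diagonal (fun i => (d i : ℂ)) * Uᴴ)
    {D : Matrix n n ℂ} (hD : D.IsHermitian) : ∃ S : Matrix n n ℂ, S.IsHermitian ∧ S * ρ + ρ * S = D :=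
  exists_sld_of_forall_add_ne_zero hU hU' (fun i j => (add_pos (hd i) (hd j)).ne') hρU hD

/-! ## § 2 Theorem 2.3 (Šafránek): the QFIM in Liouville space -/

/-- **The SLD super-operator in Liouville space** (column-stacking `vec`): `(ρᵀ ⊗ 1 + 1 ⊗ ρ) vec S = vec(Sρ + ρS)`
(«`vec(ABC) = (A ⊗ Cᵀ)vec(B)`» in the row convention). [cite: LiuYuanLuWang2020, §2.3.1 Thm 2.3 («This theorem can be proved by using the facts that `vec(AB𝟙) = …`»)] -/
theorem kroneckerSum_mulVec_vec (ρ S : Matrix n n ℂ) :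
    (ρᵀ ⊗ₖ (1 : Matrix n n ℂ) + (1 : Matrix n n ℂ) ⊗ₖ ρ) *ᵥ vec S = vec (S * ρ + ρ * S) := by
  rw [add_mulVec, kronecker_mulVec_vec, kronecker_mulVec_vec, transpose_transpose, transpose_one, Matrix.one_mul,
    Matrix.mul_one, vec_add]

/-- **The Liouville-space SLD operator of a full-rank state is positive definite** (its spectrum is `{λ_i + λ_j}`),
hence invertible. [cite: LiuYuanLuWang2020, §2.3.1 Thm 2.3 («For a full-rank density matrix»)] -/
theorem kroneckerSum_posDef {ρ : Matrix n n ℂ} (hρ : ρ.PosDef) :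
    (ρᵀ ⊗ₖ (1 : Matrix n n ℂ) + (1 : Matrix n n ℂ) ⊗ₖ ρ).PosDef :=
  (hρ.transpose.kronecker PosDef.one).add (PosDef.one.kronecker hρ)

/-- **`vec(L_a) = 2(ρ ⊗ 𝟙 + 𝟙 ⊗ ρ*)⁻¹vec(∂_aρ)`** in BF's normalisation: `vec S = M⁻¹ vec D` for the SLD `S` of a
full-rank state. [cite: LiuYuanLuWang2020, §2.3.1 Thm 2.3 (Eq. for `vec(L_a)`)] -/
theorem vec_sld_eq_inv_mulVec {ρ S D : Matrix n n ℂ} (hρ : ρ.PosDef) (hSD : S * ρ + ρ * S = D) :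
    vec S = (ρᵀ ⊗ₖ (1 : Matrix n n ℂ) + (1 : Matrix n n ℂ) ⊗ₖ ρ)⁻¹ *ᵥ vec D := by
  have hM := kroneckerSum_posDef hρ
  have hdet : IsUnit (ρᵀ ⊗ₖ (1 : Matrix n n ℂ) + (1 : Matrix n n ℂ) ⊗ₖ ρ).det :=
    (isUnit_iff_isUnit_det _).mp hM.isUnit
  rw [← hSD, ← kroneckerSum_mulVec_vec, mulVec_mulVec, nonsing_inv_mul _ hdet, one_mulVec]

/-- The printed form with `L = 2S`: `vec(2S) = 2 · M⁻¹ vec D`. [cite: LiuYuanLuWang2020, §2.3.1 Thm 2.3] -/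
theorem vec_two_smul_sld_eq {ρ S D : Matrix n n ℂ} (hρ : ρ.PosDef) (hSD : S * ρ + ρ * S = D) :
    vec ((2 : ℂ) • S) = (2 : ℂ) • ((ρᵀ ⊗ₖ (1 : Matrix n n ℂ) + (1 : Matrix n n ℂ) ⊗ₖ ρ)⁻¹ *ᵥ vec D) := by
  rw [vec_smul, vec_sld_eq_inv_mulVec hρ hSD]

omit [DecidableEq n] in
/-- **`Tr(A†B) = vec(A)†vec(B)`** applied to the QFIM: `vec(D_a)† vec(S_b) = Tr(D_a S_b) = Tr(S_aD_b)` for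
Hermitian `D_a` and any SLD solutions. [cite: LiuYuanLuWang2020, §2.3.1 Thm 2.3 («`Tr(A†B) = vec(A)†vec(B)`»)] -/
theorem star_vec_dotProduct_vec_sld {ρ : Matrix n n ℂ} {S D : ι → Matrix n n ℂ} (hD : ∀ a, (D a).IsHermitian)
    (hSD : ∀ a, S a * ρ + ρ * S a = D a) (a b : ι) :
    star (vec (D a)) ⬝ᵥ vec (S b) = (S a * D b).trace := by
  rw [star_vec_dotProduct_vec, (hD a).eq, Matrix.trace_mul_comm, trace_sld_mul_deriv_comm ρ (hSD a) (hSD b)]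

/-- **Theorem 2.3 (Šafránek 2018): `𝓕_ab = 2vec(∂_aρ)†(ρᵀ ⊗ 1 + 1 ⊗ ρ)⁻¹vec(∂_bρ)`** for a full-rank state
(column-stacking `vec`; Liu's row-stacking prints the operator as `ρ ⊗ 𝟙 + 𝟙 ⊗ ρ*`).
[cite: LiuYuanLuWang2020, §2.3.1 Thm 2.3] -/
theorem qfim_eq_two_mul_vec_inv_vec {ρ : Matrix n n ℂ} (hρ : ρ.PosDef) {S D : ι → Matrix n n ℂ}
    (hD : ∀ a, (D a).IsHermitian) (hSD : ∀ a, S a * ρ + ρ * S a = D a) {F : Matrix ι ι ℝ}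
    (hF : ∀ a b, F a b = 2 * (S a * D b).trace.re) (a b : ι) :
    F a b = 2 * (star (vec (D a)) ⬝ᵥ
      ((ρᵀ ⊗ₖ (1 : Matrix n n ℂ) + (1 : Matrix n n ℂ) ⊗ₖ ρ)⁻¹ *ᵥ vec (D b))).re := by
  rw [hF, ← vec_sld_eq_inv_mulVec hρ (hSD b), star_vec_dotProduct_vec_sld hD hSD]

/-! ## § 3 Theorem 2.6 (Dittmann 1999): the basis-independent single-qubit formula, and Cor. 2 -/

section Qubit

/-- **Polarised Cayley–Hamilton for `2 × 2` matrices**: `AB + BA = Tr(B)A + Tr(A)B + (Tr(AB) − TrA·TrB)·1`. [folklore] -/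
private theorem two_by_two_anticomm (A B : Matrix (Fin 2) (Fin 2) ℂ) :
    A * B + B * A = B.trace • A + A.trace • B + ((A * B).trace - A.trace * B.trace) • (1 : Matrix (Fin 2) (Fin 2) ℂ) := by
  ext i j
  fin_cases i <;> fin_cases j <;>
    simp [Matrix.mul_apply, Fin.sum_univ_two, Matrix.trace_fin_two] <;> ring

/-- **Cayley–Hamilton for `2 × 2` matrices**: `ρ² = Tr(ρ)ρ − det(ρ)·1`. [folklore] -/
private theorem two_by_two_sq (ρ : Matrix (Fin 2) (Fin 2) ℂ) :
    ρ * ρ = ρ.trace • ρ - ρ.det • (1 : Matrix (Fin 2) (Fin 2) ℂ) := by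
  ext i j
  fin_cases i <;> fin_cases j <;>
    simp [Matrix.mul_apply, Fin.sum_univ_two, Matrix.trace_fin_two, Matrix.det_fin_two] <;> ring

variable {ρ : Matrix (Fin 2) (Fin 2) ℂ}

/-- `ρD + Dρ = D + Tr(ρD)·1` for a qubit (`Tr ρ = 1`, `Tr D = 0`). [cite: LiuYuanLuWang2020, §2.3.3 Thm 2.6 (road via [Dittmann1999])] -/
theorem qubit_anticomm_deriv (hρ1 : ρ.trace = 1) {D : Matrix (Fin 2) (Fin 2) ℂ} (hD : D.trace = 0) :
    ρ * D + D * ρ = D + (ρ * D).trace • (1 : Matrix (Fin 2) (Fin 2) ℂ) := by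
  rw [two_by_two_anticomm, hρ1, hD, zero_smul, zero_add, one_smul, mul_zero, sub_zero]

/-- `ρDρ = Tr(ρD)ρ + det(ρ)D` for a qubit (`Tr ρ = 1`, `Tr D = 0`). [cite: LiuYuanLuWang2020, §2.3.3 Thm 2.6] -/
theorem qubit_conj_deriv (hρ1 : ρ.trace = 1) {D : Matrix (Fin 2) (Fin 2) ℂ} (hD : D.trace = 0) :
    ρ * D * ρ = (ρ * D).trace • ρ + ρ.det • D := by
  have h1 : ρ * D = D + (ρ * D).trace • (1 : Matrix (Fin 2) (Fin 2) ℂ) - D * ρ :=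
    eq_sub_of_add_eq (qubit_anticomm_deriv hρ1 hD)
  have h2 := two_by_two_sq ρ
  rw [hρ1, one_smul] at h2
  calc ρ * D * ρ = (D + (ρ * D).trace • (1 : Matrix (Fin 2) (Fin 2) ℂ) - D * ρ) * ρ := by rw [← h1]
    _ = D * ρ + (ρ * D).trace • ρ - D * (ρ * ρ) := by
        rw [Matrix.sub_mul, Matrix.add_mul, Matrix.smul_mul, Matrix.one_mul, Matrix.mul_assoc]
    _ = (ρ * D).trace • ρ + ρ.det • D := by
        rw [h2, Matrix.mul_sub, Matrix.mul_smul, Matrix.mul_one]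
        abel

/-- **An explicit SLD for a full-rank qubit**: `S = D + (Tr(ρD)/2det ρ)(ρ − 1)` solves `Sρ + ρS = D`
(`Tr ρ = 1`, `Tr D = 0`, `det ρ ≠ 0`). [cite: LiuYuanLuWang2020, §2.3.3 Thm 2.6 (the [Dittmann1999] road)] -/
theorem sld_qubit (hρ1 : ρ.trace = 1) (hdet : ρ.det ≠ 0) {D : Matrix (Fin 2) (Fin 2) ℂ} (hD : D.trace = 0) :
    (D + ((ρ * D).trace / (2 * ρ.det)) • (ρ - 1)) * ρ + ρ * (D + ((ρ * D).trace / (2 * ρ.det)) • (ρ - 1)) = D := by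
  set c : ℂ := (ρ * D).trace / (2 * ρ.det) with hc
  have h2 := two_by_two_sq ρ
  rw [hρ1, one_smul] at h2
  have hanti : D * ρ + ρ * D = D + (ρ * D).trace • (1 : Matrix (Fin 2) (Fin 2) ℂ) := by
    rw [add_comm]; exact qubit_anticomm_deriv hρ1 hD
  have hsq : (ρ - 1) * ρ + ρ * (ρ - 1) = (-(2 * ρ.det)) • (1 : Matrix (Fin 2) (Fin 2) ℂ) := by
    rw [Matrix.sub_mul, Matrix.mul_sub, Matrix.one_mul, Matrix.mul_one, h2]
    module
  have hcd : c * (-(2 * ρ.det)) = -(ρ * D).trace := by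
    rw [hc]; field_simp
  calc (D + c • (ρ - 1)) * ρ + ρ * (D + c • (ρ - 1))
      = (D * ρ + ρ * D) + c • ((ρ - 1) * ρ + ρ * (ρ - 1)) := by
        rw [Matrix.add_mul, Matrix.mul_add, Matrix.smul_mul, Matrix.mul_smul, smul_add]; abel
    _ = D := by
        rw [hanti, hsq, smul_smul, hcd, neg_smul]
        abel

/-- **`2Tr(S_aD_b) = 2Tr(D_aD_b) + Tr(ρD_a)Tr(ρD_b)/det ρ`** for a qubit and ANY solutions `S_a` of the SLD
equations (independence of the choice, g80-#1). [cite: LiuYuanLuWang2020, §2.3.3 Thm 2.6] -/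
theorem two_mul_trace_sld_qubit (hρ1 : ρ.trace = 1) (hdet : ρ.det ≠ 0) {S D : ι → Matrix (Fin 2) (Fin 2) ℂ}
    (hD : ∀ a, (D a).trace = 0) (hSD : ∀ a, S a * ρ + ρ * S a = D a) (a b : ι) :
    2 * (S a * D b).trace = 2 * (D a * D b).trace + (ρ * D a).trace * (ρ * D b).trace / ρ.det := by
  rw [trace_sld_mul_deriv_eq_of_sld_eq ρ (hSD a) (sld_qubit hρ1 hdet (hD a)) (hSD b), Matrix.add_mul,
    Matrix.smul_mul, Matrix.sub_mul, Matrix.one_mul, trace_add, trace_smul, trace_sub, hD b, sub_zero, smul_eq_mul]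
  field_simp

/-- **Theorem 2.6 (Dittmann 1999; Liu et al.): the basis-independent single-qubit QFIM**
`𝓕_ab = Tr[(∂_aρ)(∂_bρ)] + Tr[ρ(∂_aρ)ρ(∂_bρ)]/det ρ` for a `2 × 2` state with `Tr ρ = 1`, `det ρ ≠ 0` (full rank),
trace-free derivatives and any SLDs. [cite: LiuYuanLuWang2020, §2.3.3 Thm 2.6] -/
theorem qfim_qubit (hρ1 : ρ.trace = 1) (hdet : ρ.det ≠ 0) {S D : ι → Matrix (Fin 2) (Fin 2) ℂ}
    (hD : ∀ a, (D a).trace = 0) (hSD : ∀ a, S a * ρ + ρ * S a = D a) {F : Matrix ι ι ℝ}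
    (hF : ∀ a b, F a b = 2 * (S a * D b).trace.re) (a b : ι) :
    F a b = ((D a * D b).trace + (ρ * D a * ρ * D b).trace / ρ.det).re := by
  have h2 : 2 * (S a * D b).trace.re = (2 * (S a * D b).trace).re := by simp
  rw [hF, h2, two_mul_trace_sld_qubit hρ1 hdet hD hSD a b, qubit_conj_deriv hρ1 (hD a), Matrix.add_mul,
    Matrix.smul_mul, Matrix.smul_mul, trace_add, trace_smul, trace_smul, smul_eq_mul, smul_eq_mul]
  congr 1
  field_simp
  ring

/-- **Corollary 2 (single-qubit Bloch form)**: for `ρ = ½(𝟙 + r⃗·σ⃗) = ½[[1+z, x−iy],[x+iy, 1−z]]` with `|r⃗| < 1`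
(here: `x²+y²+z² ≠ 1`) and derivatives `∂_aρ = ½[[ż_a, ẋ_a−iẏ_a],[ẋ_a+iẏ_a, −ż_a]]`, any SLDs:
`𝓕_ab = (∂_ar⃗)·(∂_br⃗) + (r⃗·∂_ar⃗)(r⃗·∂_br⃗)/(1 − |r⃗|²)`. [cite: LiuYuanLuWang2020, §2.3.1 Cor. 2] -/
theorem qfim_qubit_bloch {x y z : ℝ} (hr : x ^ 2 + y ^ 2 + z ^ 2 ≠ 1) {dx dy dz : ι → ℝ}
    (hρ : ρ = (1 / 2 : ℂ) • !![1 + (z : ℂ), (x : ℂ) - (y : ℂ) * Complex.I; (x : ℂ) + (y : ℂ) * Complex.I, 1 - (z : ℂ)])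
    {S D : ι → Matrix (Fin 2) (Fin 2) ℂ}
    (hDa : ∀ a, D a = (1 / 2 : ℂ) • !![(dz a : ℂ), (dx a : ℂ) - (dy a : ℂ) * Complex.I;
      (dx a : ℂ) + (dy a : ℂ) * Complex.I, -(dz a : ℂ)])
    (hSD : ∀ a, S a * ρ + ρ * S a = D a) {F : Matrix ι ι ℝ} (hF : ∀ a b, F a b = 2 * (S a * D b).trace.re)
    (a b : ι) :
    F a b = (dx a * dx b + dy a * dy b + dz a * dz b) +
      (x * dx a + y * dy a + z * dz a) * (x * dx b + y * dy b + z * dz b) / (1 - (x ^ 2 + y ^ 2 + z ^ 2)) := by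
  have hρ1 : ρ.trace = 1 := by
    rw [hρ, trace_smul, trace_fin_two]; simp; ring
  have hdetval : ρ.det = (((1 - (x ^ 2 + y ^ 2 + z ^ 2)) / 4 : ℝ) : ℂ) := by
    rw [hρ, det_smul, det_fin_two]
    simp only [of_apply, cons_val', cons_val_zero, cons_val_one, empty_val', cons_val_fin_one, Fintype.card_fin]
    push_cast
    ring_nf
    rw [Complex.I_sq]
    ring
  have hr' : (1 - (x ^ 2 + y ^ 2 + z ^ 2)) ≠ 0 := sub_ne_zero.mpr (Ne.symm hr)
  have hdet : ρ.det ≠ 0 := by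
    rw [hdetval]; exact_mod_cast div_ne_zero hr' four_ne_zero
  have hD : ∀ a, (D a).trace = 0 := fun a => by
    rw [hDa, trace_smul, trace_fin_two]; simp
  have htD : ∀ a, (ρ * D a).trace = (((x * dx a + y * dy a + z * dz a) / 2 : ℝ) : ℂ) := fun a => by
    rw [hρ, hDa, Matrix.smul_mul, Matrix.mul_smul, trace_smul, trace_smul, trace_fin_two]
    simp only [Matrix.mul_apply, Fin.sum_univ_two, of_apply, cons_val', cons_val_zero, cons_val_one, empty_val',
      cons_val_fin_one, smul_eq_mul]
    push_cast
    ring_nf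
    rw [Complex.I_sq]
    ring
  have hDD : (D a * D b).trace = (((dx a * dx b + dy a * dy b + dz a * dz b) / 2 : ℝ) : ℂ) := by
    rw [hDa, hDa, Matrix.smul_mul, Matrix.mul_smul, trace_smul, trace_smul, trace_fin_two]
    simp only [Matrix.mul_apply, Fin.sum_univ_two, of_apply, cons_val', cons_val_zero, cons_val_one, empty_val',
      cons_val_fin_one, smul_eq_mul]
    push_cast
    ring_nf
    rw [Complex.I_sq]
    ring
  have h2 : 2 * (S a * D b).trace.re = (2 * (S a * D b).trace).re := by simp
  rw [hF, h2, two_mul_trace_sld_qubit hρ1 hdet hD hSD, hDD, htD, htD, hdetval]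
  have e : (2 : ℂ) * (((dx a * dx b + dy a * dy b + dz a * dz b) / 2 : ℝ) : ℂ) +
      (((x * dx a + y * dy a + z * dz a) / 2 : ℝ) : ℂ) * (((x * dx b + y * dy b + z * dz b) / 2 : ℝ) : ℂ) /
        (((1 - (x ^ 2 + y ^ 2 + z ^ 2)) / 4 : ℝ) : ℂ) =
      (((dx a * dx b + dy a * dy b + dz a * dz b) +
        (x * dx a + y * dy a + z * dz a) * (x * dx b + y * dy b + z * dz b) / (1 - (x ^ 2 + y ^ 2 + z ^ 2)) : ℝ) : ℂ) := by
    push_cast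
    field_simp
    ring
  rw [e, Complex.ofReal_re]

end Qubit

end Literature.InformationTheory.StateDiscrimination.QFIMFormulas

end
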